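import Summits.ValiantsHypothesis.ValiantsHypothesis.Theorems.LacunarySymmetroidMatrixDescartesCensusPivotTwoSmallRows
import Summits.ValiantsHypothesis.ValiantsHypothesis.Theorems.LacunarySymmetroidMatrixDescartesPivotTwoFourWitness

/-!
# `MatrixDescartes` census — pivot column at `m = 2`: the row `(2,2)` is exactly `4` ALREADY AT INDEX ONE

HONEST FRAMING.  Object-search cell `pub-symmetroid`, Conjecture-B column in PIVOT currency (`…CensusPivotDefs.lean`, seat conjb-1),
seat `val-sym-mdr-p1` (generation 6).  Helper file landed `--supports` the crux item stmt-ValiantsHypothesis-18050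
(`Theses.LacunarySymmetroid.MatrixDescartes`, OPEN, on HOLD) with NO closure claim.  Sequel of `…CensusPivotTwoSmallRows.lean`
(`PivotRootLawAt 2 2 q 4` for every `q`, sharp at index two): here an INDEX-ONE witness with four positive roots, so the `(2,2)` row of
conjb-1's index-1 column (`RankOnePivotLawBilinear` predicts `2(m−1)(K−1) + 2 = 4` there, «tight at (2,2)») is exactly `4`:
* **`not_pivotRootLawAt_two_two_one_three`**: pivot `J = diag(−1, 0)` (index one: `J + e₁e₁ᵀ = 0 ⪰ 0`) at exponent `5`, PSD letters
  `P₁ = [[93/25, −189/100],[−189/100, 49/50]]` at exponent `0` and `P₂ = [[8/25, −39/100],[−39/100, 73/100]]` at exponent `8`;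
  `det F(t) = 147/2000 − (49/50)t⁵ + (311/200)t⁸ − (73/100)t¹³ + (163/2000)t¹⁶` alternates `+ − + − +` at `1/2 < 4/5 < 24/25 < 3/2 < 3`
  (exact rational certificate), so `Z₊ ≥ 4 > 3`.  Found by a random search over two-sided two-letter pencils with a rank-one NSD pivot
  (seat exp/k2idx1b.py); the configuration is thin (roots ≈ 0.67, 0.92, 1.00, 2.04).
* **`pivotRootLawAt_two_two_one_iff : PivotRootLawAt 2 2 1 B ↔ 4 ≤ B`** — with g5's `(2,3)`: the index-1 column at `m = 2` reads
  `1, 4, 6, ≥ 8` for `K = 1, 2, 3, 4` (`K = 1`: R0).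
Nothing here bears on `Theses.LacunarySymmetroid.MatrixDescartes` in its window, on `KPlusLogSqLaw`, on `DoorA26` / `DoorA34`, on the
cell's registers or credences, or on `VP ≠ VNP`.

[folklore] Intermediate value theorem via the tree's certificate kit (`Pivot.not_pivotRootLawAt_of_certificate`); `2 × 2` PSD test
`PivotTwoFourWitness.posSemidef_two_of_entries`.  No definitions, no named facts.
-/

-- `Summit.ValiantsHypothesis.ValiantsHypothesis.…` repeats a component by the D-0017 layout
-- (single-conjunct summit), which the `dupNamespace` linter flags; the name is mandated.
set_option linter.dupNamespace false

namespace Summit.ValiantsHypothesis.ValiantsHypothesis.Theorems.LacunarySymmetroidMatrixDescartes.Pivot.SmallRows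

open Matrix Finset Polynomial
open scoped BigOperators

/-- Closed form of `det F(t)` for the `(2,2)` index-one witness (the literals ARE the certificate's data). [folklore] -/
theorem witnessTwoIdx1_eval_det (t : ℝ) :
    (t ^ 5 • (!![-1, 0; 0, 0] : Matrix (Fin 2) (Fin 2) ℝ)
      + ∑ k, t ^ (![0, 8] : Fin 2 → ℕ) k •
        (![!![93 / 25, -189 / 100; -189 / 100, 49 / 50], !![8 / 25, -39 / 100; -39 / 100, 73 / 100]]
          : Fin 2 → Matrix (Fin 2) (Fin 2) ℝ) k).det
      = 147 / 2000 - 49 / 50 * t ^ 5 + 311 / 200 * t ^ 8 - 73 / 100 * t ^ 13 + 163 / 2000 * t ^ 16 := by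
  rw [Matrix.det_fin_two]
  simp [Matrix.add_apply, Fin.sum_univ_two]
  ring

/-- The pivot `diag(−1, 0)` has index one: `J + W Wᵀ = 0` for `W = e₁`. [folklore] -/
theorem witnessTwoIdx1_index_one :
    ((!![-1, 0; 0, 0] : Matrix (Fin 2) (Fin 2) ℝ)
      + (!![1; 0] : Matrix (Fin 2) (Fin 1) ℝ) * (!![1; 0] : Matrix (Fin 2) (Fin 1) ℝ)ᵀ).PosSemidef := by
  have h : (!![-1, 0; 0, 0] : Matrix (Fin 2) (Fin 2) ℝ)
      + (!![1; 0] : Matrix (Fin 2) (Fin 1) ℝ) * (!![1; 0] : Matrix (Fin 2) (Fin 1) ℝ)ᵀ = 0 := by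
    ext i j
    fin_cases i <;> fin_cases j <;>
      norm_num [Matrix.mul_apply, Matrix.transpose_apply, Matrix.vecHead, Matrix.vecTail]
  rw [h]
  exact Matrix.PosSemidef.zero

/-- **`(2,2)` is sharp already at index ONE**: `¬ PivotRootLawAt 2 2 1 3` (four positive roots; signs `+ − + − +` of the closed form
at `1/2 < 4/5 < 24/25 < 3/2 < 3`). [folklore] -/
theorem not_pivotRootLawAt_two_two_one_three : ¬ PivotRootLawAt 2 2 1 3 :=
  not_pivotRootLawAt_of_certificate (N := 4) witnessTwoIdx1_eval_det
    (by unfold Matrix.IsSymm; ext i j; fin_cases i <;> fin_cases j <;> rfl)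
    (by
      intro k
      fin_cases k
      · simpa using PivotTwoFourWitness.posSemidef_two_of_entries (93 / 25) (-189 / 100) (49 / 50)
          (by norm_num) (by norm_num) (by norm_num)
      · simpa using PivotTwoFourWitness.posSemidef_two_of_entries (8 / 25) (-39 / 100) (73 / 100)
          (by norm_num) (by norm_num) (by norm_num))
    (!![1; 0] : Matrix (Fin 2) (Fin 1) ℝ) witnessTwoIdx1_index_one
    ![1 / 2, 4 / 5, 24 / 25, 3 / 2, 3]
    (by
      refine Fin.strictMono_iff_lt_succ.2 fun j => ?_
      fin_cases j <;> simp only [Fin.castSucc_mk, Fin.succ_mk] <;> norm_num)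
    (by intro j; fin_cases j <;> norm_num)
    (by intro j; fin_cases j <;> simp only [Fin.castSucc_mk, Fin.succ_mk] <;> norm_num)
    (by norm_num)

/-- **Row `(2,2)` at index one is exactly `4`**: `PivotRootLawAt 2 2 1 B ↔ 4 ≤ B`. [folklore] -/
theorem pivotRootLawAt_two_two_one_iff (B : ℕ) : PivotRootLawAt 2 2 1 B ↔ 4 ≤ B := by
  constructor
  · intro h
    by_contra hB
    exact not_pivotRootLawAt_two_two_one_three (pivotRootLawAt_mono h (by omega))
  · intro hB
    exact pivotRootLawAt_mono (pivotRootLawAt_two_two 1) hB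

end Summit.ValiantsHypothesis.ValiantsHypothesis.Theorems.LacunarySymmetroidMatrixDescartes.Pivot.SmallRows
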